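import Mathlib
import Summits.Ventures.HodgeRepro2.T5AdicCompletionIntegralBasis
import Summits.Ventures.HodgeRepro2.T5InertCharacterCount
import Summits.Ventures.HodgeRepro2.T5RamifiedCharacterCount
import Summits.Ventures.HodgeRepro2.T5TwistedCharacterCount

/-!
# The character counts of Lemma N5.L4(iii)/(iv) on Mathlib's completions with `q = N(v)` and NO
  cardinality hypothesis

`T5InertCharacterCount` / `T5RamifiedCharacterCount` count the conjugate-orthogonal characters of
`Lw^×` of bounded / exact conductor under the hypotheses «`|k(O_Kv)| = q`, `|k(O_Lw)| = q²`
(inert) resp. `q` (ramified), with the unit cardinalities».  `T5AdicCompletionIntegralBasis` now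
DERIVES those cardinalities (`card_residueField_of_quadratic_inert` / `_ramified`, `Nat.card_units`,
`T5AdicCompletionResidueField.card_residueField`), so the counts hold with `q = N(v)` from
`[Lw : Kv] = 2` and the inert / ramified clause alone:

* inert: `(N(v)+1) N(v)^{n−1}` of conductor `≤ n`, `N(v)` of conductor exactly `1`,
  `(N(v)+1)(N(v)−1)` of conductor exactly `2`;
* inert, conjugate-SYMPLECTIC (`ξ|_{F_v^×} = μ|_{F_v^×}`, `μ` unramified — the sentence as printed):
  `(N(v)+1) N(v)^{n−1}`, `N(v)`, `(N(v)+1)(N(v)−1)`;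
* ramified: `2 N(v)^k` of conductor `≤ 2k`.

Declaration per README §8(d): «uses an L-value-free non-vanishing device: NO».
-/

namespace Summit.Ventures.HodgeRepro2.T5CompletionCharacterCounts

open IsDedekindDomain HeightOneSpectrum IsLocalRing T5AdicCompletionIntegralBasis

variable {K : Type*} [Field K] [NumberField K] (v : HeightOneSpectrum (NumberField.RingOfIntegers K))
  {L : Type*} [Field L] [NumberField L] [Algebra K L]
  (w : HeightOneSpectrum (NumberField.RingOfIntegers L)) [w.asIdeal.LiesOver v.asIdeal]

section Inert

variable (h2 : Module.finrank (adicCompletion K v) (adicCompletion L w) = 2)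
  {ϖ : adicCompletionIntegers K v} (hϖ : Irreducible ϖ)
  (hϖS : Irreducible (algebraMap (adicCompletionIntegers K v) (adicCompletionIntegers L w) ϖ))

include h2 hϖ hϖS

/-- Inert: `(N(v)+1) N(v)^{n−1}` conjugate-orthogonal characters of conductor `≤ n` (`n ≥ 1`). -/
theorem ncard_conjugateOrthogonal_le {n : ℕ} (hn : 1 ≤ n) :
    {χ : (adicCompletion L w)ˣ →* ℂˣ | ∀ y ∈ (T5UnramifiedCharacter.baseUnits v w).range ⊔
        Subgroup.map (Units.map (algebraMap (adicCompletionIntegers L w) (adicCompletion L w) :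
          adicCompletionIntegers L w →* adicCompletion L w))
          (T5PrincipalUnitFiltration.higherUnits
            (algebraMap (adicCompletionIntegers K v) (adicCompletionIntegers L w) ϖ) n),
        χ y = 1}.ncard = (Ideal.absNorm v.asIdeal + 1) * Ideal.absNorm v.asIdeal ^ (n - 1) := by
  rw [← T5AdicCompletionResidueField.card_residueField]
  exact T5InertCharacterCount.ncard_conjugateOrthogonal_le v w hϖ hϖS (two_le_card_residueField v)
    rfl (by rw [Nat.card_units]) (card_residueField_of_quadratic_inert v w h2 hϖ hϖS)
    (by rw [Nat.card_units, card_residueField_of_quadratic_inert v w h2 hϖ hϖS]) hn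

/-- Inert: exactly `N(v)` conjugate-orthogonal characters of conductor `1`. -/
theorem ncard_conjugateOrthogonal_exact_one :
    {χ : (adicCompletion L w)ˣ →* ℂˣ | (∀ y ∈ (T5UnramifiedCharacter.baseUnits v w).range ⊔
        Subgroup.map (Units.map (algebraMap (adicCompletionIntegers L w) (adicCompletion L w) :
          adicCompletionIntegers L w →* adicCompletion L w))
          (T5PrincipalUnitFiltration.higherUnits
            (algebraMap (adicCompletionIntegers K v) (adicCompletionIntegers L w) ϖ) 1),
        χ y = 1) ∧ ¬ ∀ y ∈ (T5UnramifiedCharacter.baseUnits v w).range ⊔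
        Subgroup.map (Units.map (algebraMap (adicCompletionIntegers L w) (adicCompletion L w) :
          adicCompletionIntegers L w →* adicCompletion L w))
          (T5PrincipalUnitFiltration.higherUnits
            (algebraMap (adicCompletionIntegers K v) (adicCompletionIntegers L w) ϖ) 0),
        χ y = 1}.ncard = Ideal.absNorm v.asIdeal := by
  rw [← T5AdicCompletionResidueField.card_residueField]
  exact T5InertCharacterCount.ncard_conjugateOrthogonal_exact_one v w hϖ hϖS
    (two_le_card_residueField v) rfl (by rw [Nat.card_units])
    (card_residueField_of_quadratic_inert v w h2 hϖ hϖS)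
    (by rw [Nat.card_units, card_residueField_of_quadratic_inert v w h2 hϖ hϖS])

/-- Inert: exactly `(N(v)+1)(N(v)−1)` conjugate-orthogonal characters of conductor `2`. -/
theorem ncard_conjugateOrthogonal_exact_two :
    {χ : (adicCompletion L w)ˣ →* ℂˣ | (∀ y ∈ (T5UnramifiedCharacter.baseUnits v w).range ⊔
        Subgroup.map (Units.map (algebraMap (adicCompletionIntegers L w) (adicCompletion L w) :
          adicCompletionIntegers L w →* adicCompletion L w))
          (T5PrincipalUnitFiltration.higherUnits
            (algebraMap (adicCompletionIntegers K v) (adicCompletionIntegers L w) ϖ) 2),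
        χ y = 1) ∧ ¬ ∀ y ∈ (T5UnramifiedCharacter.baseUnits v w).range ⊔
        Subgroup.map (Units.map (algebraMap (adicCompletionIntegers L w) (adicCompletion L w) :
          adicCompletionIntegers L w →* adicCompletion L w))
          (T5PrincipalUnitFiltration.higherUnits
            (algebraMap (adicCompletionIntegers K v) (adicCompletionIntegers L w) ϖ) 1),
        χ y = 1}.ncard = (Ideal.absNorm v.asIdeal + 1) * (Ideal.absNorm v.asIdeal - 1) := by
  rw [← T5AdicCompletionResidueField.card_residueField]
  exact T5InertCharacterCount.ncard_conjugateOrthogonal_exact_two v w hϖ hϖS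
    (two_le_card_residueField v) rfl (by rw [Nat.card_units])
    (card_residueField_of_quadratic_inert v w h2 hϖ hϖS)
    (by rw [Nat.card_units, card_residueField_of_quadratic_inert v w h2 hϖ hϖS])

end Inert

section InertSymplectic

variable (h2 : Module.finrank (adicCompletion K v) (adicCompletion L w) = 2)
  {ϖ : adicCompletionIntegers K v} (hϖ : Irreducible ϖ)
  (hϖS : Irreducible (algebraMap (adicCompletionIntegers K v) (adicCompletionIntegers L w) ϖ))
  (μ : (adicCompletion L w)ˣ →* ℂˣ)
  (hμ : ∀ y ∈ Subgroup.map (Units.map (algebraMap (adicCompletionIntegers L w) (adicCompletion L w) :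
      adicCompletionIntegers L w →* adicCompletion L w))
      (T5PrincipalUnitFiltration.higherUnits
        (algebraMap (adicCompletionIntegers K v) (adicCompletionIntegers L w) ϖ) 0), μ y = 1)

include h2 hϖ hϖS hμ

/-- Inert, conjugate-symplectic (`ξ = μ` on `F_v^×`, `μ` unramified): `(N(v)+1) N(v)^{n−1}` of
conductor `≤ n` — Lemma N5.L4(iii)'s «the conjugate-symplectic characters of conductor ≤ n are `μθ`,
`θ` a character of `E_v^×/F_v^× U_E^n`» as a count. -/
theorem ncard_conjugateSymplectic_le {n : ℕ} (hn : 1 ≤ n) :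
    {ξ : (adicCompletion L w)ˣ →* ℂˣ | (∀ y ∈ (T5UnramifiedCharacter.baseUnits v w).range, ξ y = μ y) ∧
        ∀ y ∈ Subgroup.map (Units.map (algebraMap (adicCompletionIntegers L w) (adicCompletion L w) :
          adicCompletionIntegers L w →* adicCompletion L w))
          (T5PrincipalUnitFiltration.higherUnits
            (algebraMap (adicCompletionIntegers K v) (adicCompletionIntegers L w) ϖ) n),
        ξ y = 1}.ncard = (Ideal.absNorm v.asIdeal + 1) * Ideal.absNorm v.asIdeal ^ (n - 1) := by
  rw [← T5AdicCompletionResidueField.card_residueField]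
  exact T5TwistedCharacterCount.ncard_conjugateSymplectic_le v w hϖ hϖS (two_le_card_residueField v)
    rfl (by rw [Nat.card_units]) (card_residueField_of_quadratic_inert v w h2 hϖ hϖS)
    (by rw [Nat.card_units, card_residueField_of_quadratic_inert v w h2 hϖ hϖS]) μ hμ hn

/-- Inert: exactly `N(v)` conjugate-symplectic characters of conductor `1` («`μλ̃`, `λ` a non-trivial
character of `k_E^×/k_F^×`»). -/
theorem ncard_conjugateSymplectic_exact_one :
    {ξ : (adicCompletion L w)ˣ →* ℂˣ | ((∀ y ∈ (T5UnramifiedCharacter.baseUnits v w).range, ξ y = μ y) ∧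
        ∀ y ∈ Subgroup.map (Units.map (algebraMap (adicCompletionIntegers L w) (adicCompletion L w) :
          adicCompletionIntegers L w →* adicCompletion L w))
          (T5PrincipalUnitFiltration.higherUnits
            (algebraMap (adicCompletionIntegers K v) (adicCompletionIntegers L w) ϖ) 1),
        ξ y = 1) ∧ ¬ ∀ y ∈ Subgroup.map (Units.map (algebraMap (adicCompletionIntegers L w) (adicCompletion L w) :
          adicCompletionIntegers L w →* adicCompletion L w))
          (T5PrincipalUnitFiltration.higherUnits
            (algebraMap (adicCompletionIntegers K v) (adicCompletionIntegers L w) ϖ) 0),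
        ξ y = 1}.ncard = Ideal.absNorm v.asIdeal := by
  rw [← T5AdicCompletionResidueField.card_residueField]
  exact T5TwistedCharacterCount.ncard_conjugateSymplectic_exact_one v w hϖ hϖS
    (two_le_card_residueField v) rfl (by rw [Nat.card_units])
    (card_residueField_of_quadratic_inert v w h2 hϖ hϖS)
    (by rw [Nat.card_units, card_residueField_of_quadratic_inert v w h2 hϖ hϖS]) μ hμ

/-- Inert: exactly `(N(v)+1)(N(v)−1)` conjugate-symplectic characters of conductor `2`. -/
theorem ncard_conjugateSymplectic_exact_two :
    {ξ : (adicCompletion L w)ˣ →* ℂˣ | ((∀ y ∈ (T5UnramifiedCharacter.baseUnits v w).range, ξ y = μ y) ∧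
        ∀ y ∈ Subgroup.map (Units.map (algebraMap (adicCompletionIntegers L w) (adicCompletion L w) :
          adicCompletionIntegers L w →* adicCompletion L w))
          (T5PrincipalUnitFiltration.higherUnits
            (algebraMap (adicCompletionIntegers K v) (adicCompletionIntegers L w) ϖ) 2),
        ξ y = 1) ∧ ¬ ∀ y ∈ Subgroup.map (Units.map (algebraMap (adicCompletionIntegers L w) (adicCompletion L w) :
          adicCompletionIntegers L w →* adicCompletion L w))
          (T5PrincipalUnitFiltration.higherUnits
            (algebraMap (adicCompletionIntegers K v) (adicCompletionIntegers L w) ϖ) 1),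
        ξ y = 1}.ncard = (Ideal.absNorm v.asIdeal + 1) * (Ideal.absNorm v.asIdeal - 1) := by
  rw [← T5AdicCompletionResidueField.card_residueField]
  exact T5TwistedCharacterCount.ncard_conjugateSymplectic_exact_two v w hϖ hϖS
    (two_le_card_residueField v) rfl (by rw [Nat.card_units])
    (card_residueField_of_quadratic_inert v w h2 hϖ hϖS)
    (by rw [Nat.card_units, card_residueField_of_quadratic_inert v w h2 hϖ hϖS]) μ hμ

end InertSymplectic

section Ramified

variable (h2 : Module.finrank (adicCompletion K v) (adicCompletion L w) = 2)
  {ϖ : adicCompletionIntegers K v} (hϖ : Irreducible ϖ) {π : adicCompletionIntegers L w}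
  (hπ : Irreducible π)
  (hϖS : ¬ Irreducible (algebraMap (adicCompletionIntegers K v) (adicCompletionIntegers L w) ϖ))

include h2 hϖ hπ hϖS

/-- Ramified: `2 N(v)^k` conjugate-orthogonal characters of conductor `≤ 2k` (`k ≥ 1`). -/
theorem ncard_conjugateOrthogonal_two_mul {k : ℕ} (hk : 1 ≤ k) :
    {χ : (adicCompletion L w)ˣ →* ℂˣ | ∀ y ∈ (T5UnramifiedCharacter.baseUnits v w).range ⊔
        Subgroup.map (Units.map (algebraMap (adicCompletionIntegers L w) (adicCompletion L w) :
          adicCompletionIntegers L w →* adicCompletion L w))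
          (T5PrincipalUnitFiltration.higherUnits π (2 * k)),
        χ y = 1}.ncard = 2 * Ideal.absNorm v.asIdeal ^ k := by
  rw [← T5AdicCompletionResidueField.card_residueField]
  exact T5RamifiedCharacterCount.ncard_conjugateOrthogonal_two_mul v w h2 hϖ hπ hϖS
    (two_le_card_residueField v) rfl (by rw [Nat.card_units])
    (card_residueField_of_quadratic_ramified v w h2 hϖ hϖS)
    (by rw [Nat.card_units, card_residueField_of_quadratic_ramified v w h2 hϖ hϖS]) hk

/-- Ramified: exactly `2 N(v)^k − 2 N(v)^{k−1}` conjugate-orthogonal characters of conductor `2k`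
(`k ≥ 2`). -/
theorem ncard_conjugateOrthogonal_exact_two_mul {k : ℕ} (hk : 2 ≤ k) :
    {χ : (adicCompletion L w)ˣ →* ℂˣ | (∀ y ∈ (T5UnramifiedCharacter.baseUnits v w).range ⊔
        Subgroup.map (Units.map (algebraMap (adicCompletionIntegers L w) (adicCompletion L w) :
          adicCompletionIntegers L w →* adicCompletion L w))
          (T5PrincipalUnitFiltration.higherUnits π (2 * k)),
        χ y = 1) ∧ ¬ ∀ y ∈ (T5UnramifiedCharacter.baseUnits v w).range ⊔
        Subgroup.map (Units.map (algebraMap (adicCompletionIntegers L w) (adicCompletion L w) :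
          adicCompletionIntegers L w →* adicCompletion L w))
          (T5PrincipalUnitFiltration.higherUnits π (2 * k - 1)),
        χ y = 1}.ncard = 2 * Ideal.absNorm v.asIdeal ^ k - 2 * Ideal.absNorm v.asIdeal ^ (k - 1) := by
  rw [← T5AdicCompletionResidueField.card_residueField]
  exact T5RamifiedCharacterCount.ncard_conjugateOrthogonal_exact_two_mul v w h2 hϖ hπ hϖS
    (two_le_card_residueField v) rfl (by rw [Nat.card_units])
    (card_residueField_of_quadratic_ramified v w h2 hϖ hϖS)
    (by rw [Nat.card_units, card_residueField_of_quadratic_ramified v w h2 hϖ hϖS]) hk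

end Ramified

end Summit.Ventures.HodgeRepro2.T5CompletionCharacterCounts
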